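import Mathlib.NumberTheory.Padics.MahlerBasis
import Mathlib.RingTheory.Polynomial.Pochhammer
import Mathlib.Analysis.Normed.Group.Ultra
import Mathlib.Analysis.Normed.Algebra.Ultra
import Mathlib.Tactic
import HarnessLib

/-!
# If all binomial coefficients `C(x, n)` are `p`-integral then `x ∈ ℤ_p`
# (converse of Gouvêa, *p-adic Numbers*, §5.9 Lemma 5.9.1)

Topic `NumberTheory/LocalFields`; namespace `Literature.NumberTheory.LocalFields`. Everything here is
proved (theorems only; no definitions, no named facts). `F` is a normed field which is a normed
`ℚ_p`-algebra (`ℚ_p`, its finite extensions, `ℂ_p`, …); `ℤ_p ↪ F` is `algebraMap ℚ_[p] F ∘ (↑)`.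

F. Q. Gouvêa, *p-adic Numbers*, §5.9 Lemma 5.9.1: "If `α ∈ ℤ_p` and `n ≥ 0`, then `C(α, n) ∈ ℤ_p`"
(Mathlib: `BinomialRing ℤ_[p]`, `Ring.choose`). This file proves the CONVERSE, in the form needed to
decide when a binomial power `(1 + T)^x = Σ C(x, n) Tⁿ` (`x ∈ ℂ_p`) has `p`-integral coefficients
(equivalently, when `u ↦ u^x` is a character of the one-units that is an Iwasawa function) —
Gouvêa's **Problem 194** ("Study the convergence properties of the binomial series when `α` is not a
p-adic integer", held text p. 132) in the integrality currency:

* **`exists_padicInt_eq_of_norm_descPochhammer_le`** — if `x ∈ F` satisfies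
  `‖x(x−1)⋯(x−n+1)‖ ≤ ‖n!‖` for every `n` (i.e. every `C(x, n) = x(x−1)⋯(x−n+1)/n!` has norm `≤ 1`),
  then `x` is (the image of) an element of `ℤ_p`. Only the exponents `n = p^N` are used
  (`exists_padicInt_eq_of_norm_descPochhammer_prime_pow_le`).
* `norm_descPochhammer_le_of_padicInt` — the direction of Lemma 5.9.1 in the same currency, and the
  `iff` `norm_descPochhammer_le_iff_mem_range_padicInt`.

Proof (digit extraction). From `n = p`: `∏_{j<p} ‖x − j‖ ≤ ‖p!‖ = ‖p‖ < 1` with every factor `≤ 1`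
forces one factor `‖x − d‖ < 1` (`d < p`), the others then have norm `1` (`‖d − j‖ = 1`), so
`‖x − d‖ ≤ ‖p‖` and `y = (x − d)/p` has `‖y‖ ≤ 1`. The hypothesis DESCENDS to `y`: in
`∏_{j<p^{N+1}} (x − j)` the factors with `j ≢ d (mod p)` have norm `1` and the others are
`x − d − pi = p(y − i)`, `i < p^N`, so `‖p‖^{p^N}·‖∏_{i<p^N}(y − i)‖ ≤ ‖(p^{N+1})!‖ = ‖p‖^{p^N}‖(p^N)!‖`
(Legendre: `v_p((pn)!) = v_p(n!) + n`, Mathlib `padicValNat_factorial_mul`). Iterating,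
`‖x − (d₀ + d₁p + ⋯ + d_{k−1}p^{k−1})‖ ≤ ‖p‖^k` for all `k`, and the image of the compact `ℤ_p` is
closed.

## References

* F. Q. Gouvêa, *p-adic Numbers: An Introduction*, Universitext, Springer 1993, §5.9 Lemma 5.9.1
  (held text pp. 131–132). [Gouvea1993PadicNumbers]
-/

noncomputable section

open Finset Filter Topology

namespace Literature.NumberTheory.LocalFields

variable {p : ℕ} [hp : Fact p.Prime] {F : Type*} [NormedField F] [instF : NormedAlgebra ℚ_[p] F]

/-! ## §0. Norms of natural numbers in a normed `ℚ_p`-algebra -/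

/-- `‖n‖_F = |n|_p`. [folklore] -/
private theorem bci_norm_natCast (n : ℕ) : ‖(n : F)‖ = ‖(n : ℚ_[p])‖ := by
  rw [← map_natCast (algebraMap ℚ_[p] F) n, norm_algebraMap']

/-- `‖z‖_F = |z|_p` for `z ∈ ℤ`. [folklore] -/
private theorem bci_norm_intCast (z : ℤ) : ‖(z : F)‖ = ‖(z : ℚ_[p])‖ := by
  rw [← map_intCast (algebraMap ℚ_[p] F) z, norm_algebraMap']

include instF in
/-- `‖n‖_F ≤ 1`. [folklore] -/
private theorem bci_norm_natCast_le_one (n : ℕ) : ‖(n : F)‖ ≤ 1 := by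
  rw [bci_norm_natCast (p := p)]
  exact_mod_cast Padic.norm_int_le_one (p := p) n

/-- `‖p‖_F = p⁻¹`. [folklore] -/
private theorem bci_norm_p : ‖(p : F)‖ = (p : ℝ)⁻¹ := by
  rw [bci_norm_natCast (p := p), Padic.norm_p]

/-- `0 < ‖p‖_F < 1`. [folklore] -/
private theorem bci_norm_p_pos : 0 < ‖(p : F)‖ := by
  rw [bci_norm_p (p := p)]; exact inv_pos.2 (by exact_mod_cast hp.out.pos)

/-- `‖p‖_F < 1`. [folklore] -/
private theorem bci_norm_p_lt_one : ‖(p : F)‖ < 1 := by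
  rw [bci_norm_p (p := p)]; exact inv_lt_one_of_one_lt₀ (by exact_mod_cast hp.out.one_lt)

/-- `p ≠ 0` in `F`. [folklore] -/
private theorem bci_p_ne_zero : (p : F) ≠ 0 :=
  norm_pos_iff.1 (bci_norm_p_pos (p := p))

/-- `‖z‖_F = 1` for an integer `z` prime to `p`. [folklore] -/
private theorem bci_norm_intCast_eq_one {z : ℤ} (hz : ¬ (p : ℤ) ∣ z) : ‖(z : F)‖ = 1 := by
  rw [bci_norm_intCast (p := p)]
  exact le_antisymm (Padic.norm_int_le_one z)
    (not_lt.1 fun h ↦ hz (Padic.norm_intCast_lt_one_iff.1 h))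

/-- `‖n‖_F = p^{-v_p(n)}` for `n ≠ 0`. [folklore] -/
private theorem bci_norm_natCast_eq_zpow {n : ℕ} (hn : n ≠ 0) :
    ‖(n : F)‖ = (p : ℝ) ^ (-(padicValNat p n : ℤ)) := by
  rw [bci_norm_natCast (p := p),
    Padic.norm_eq_zpow_neg_valuation (by exact_mod_cast hn), Padic.valuation_natCast]

/-- Legendre in norm form: `‖(p·n)!‖ = ‖p‖ⁿ · ‖n!‖`. [folklore] -/
private theorem bci_norm_factorial_mul (n : ℕ) :
    ‖((p * n).factorial : F)‖ = ‖(p : F)‖ ^ n * ‖(n.factorial : F)‖ := by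
  rw [bci_norm_natCast_eq_zpow (p := p) (Nat.factorial_ne_zero _),
    bci_norm_natCast_eq_zpow (p := p) (Nat.factorial_ne_zero _), padicValNat_factorial_mul,
    bci_norm_p (p := p)]
  have hp0 : (p : ℝ) ≠ 0 := by exact_mod_cast hp.out.ne_zero
  rw [← zpow_neg_one, ← zpow_natCast, ← zpow_mul, ← zpow_add₀ hp0]
  congr 1
  push_cast
  ring

/-- Ultrametric inequality for a difference. [folklore] -/
private theorem bci_norm_sub_le_max [IsUltrametricDist F] (x y : F) : ‖x - y‖ ≤ max ‖x‖ ‖y‖ := by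
  rw [sub_eq_add_neg, ← norm_neg y]; exact IsUltrametricDist.norm_add_le_max x (-y)

omit hp in
/-- Two distinct naturals `< p` are incongruent mod `p`. [folklore] -/
private theorem bci_not_dvd_sub {d j : ℕ} (hd : d < p) (hj : j < p) (hne : d ≠ j) :
    ¬ (p : ℤ) ∣ ((d : ℤ) - j) := by
  intro hdvd
  have h0 : ((d : ℤ) - j) = 0 := Int.eq_zero_of_abs_lt_dvd hdvd (by rw [abs_lt]; omega)
  omega

/-! ## §1. The digit: `∏_{j<p} ‖x − j‖ ≤ ‖p!‖` forces `‖x − d‖ ≤ ‖p‖` for some `d < p` -/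

/-- For naturals `d ≢ j (mod p)`: `‖x − j‖ = 1` as soon as `‖x − d‖ < 1` (ultrametric:
`x − j = (x − d) + (d − j)` with `‖d − j‖ = 1`). [folklore] -/
private theorem bci_norm_sub_natCast_eq_one {x : F} {d j : ℕ} (hxd : ‖x - d‖ < 1)
    (hdj : ¬ (p : ℤ) ∣ ((d : ℤ) - j)) : ‖x - j‖ = 1 := by
  have : IsUltrametricDist F := IsUltrametricDist.of_normedAlgebra ℚ_[p]
  have h1 : ‖((d : F) - j)‖ = 1 := by
    have := bci_norm_intCast_eq_one (F := F) (p := p) hdj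
    push_cast at this
    exact this
  have hsplit : x - j = (x - d) + ((d : F) - j) := by ring
  rw [hsplit, IsUltrametricDist.norm_add_eq_max_of_norm_ne_norm (by rw [h1]; exact hxd.ne), h1]
  exact max_eq_right hxd.le

/-- **The digit step.** If `‖x‖ ≤ 1` and `‖∏_{j<p}(x − j)‖ ≤ ‖p!‖` then `‖x − d‖ ≤ ‖p‖` for some
`d < p` (so `x = d + p·y` with `‖y‖ ≤ 1`): the first `p`-adic digit of `x`.
[cite: Gouvea1993PadicNumbers, §5.9 Lemma 5.9.1 (converse) and Problem 194] -/
theorem exists_digit_of_norm_descPochhammer_le {x : F} (hx : ‖x‖ ≤ 1)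
    (h : ‖∏ j ∈ range p, (x - (j : F))‖ ≤ ‖(p.factorial : F)‖) :
    ∃ d : ℕ, d < p ∧ ‖x - d‖ ≤ ‖(p : F)‖ := by
  have : IsUltrametricDist F := IsUltrametricDist.of_normedAlgebra ℚ_[p]
  -- `‖p!‖ = ‖p‖`
  have hfact : ‖(p.factorial : F)‖ = ‖(p : F)‖ := by
    have := bci_norm_factorial_mul (F := F) (p := p) 1
    simpa using this
  rw [hfact, norm_prod] at h
  -- every factor has norm `≤ 1`
  have hle : ∀ j ∈ range p, ‖x - (j : F)‖ ≤ 1 := fun j _ ↦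
    (bci_norm_sub_le_max x (j : F)).trans (max_le hx (bci_norm_natCast_le_one (p := p) j))
  -- some factor has norm `< 1`
  obtain ⟨d, hd, hdx⟩ : ∃ d ∈ range p, ‖x - (d : F)‖ < 1 := by
    by_contra hcon
    push Not at hcon
    have h1 : ∏ j ∈ range p, ‖x - (j : F)‖ = 1 :=
      prod_eq_one fun j hj ↦ le_antisymm (hle j hj) (hcon j hj)
    rw [h1] at h
    exact absurd h (not_le.2 (bci_norm_p_lt_one (p := p)))
  refine ⟨d, mem_range.1 hd, ?_⟩
  -- the other factors have norm exactly `1`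
  have hothers : ∏ j ∈ (range p).erase d, ‖x - (j : F)‖ = 1 := by
    refine prod_eq_one fun j hj ↦ ?_
    obtain ⟨hjd, hjp⟩ := mem_erase.1 hj
    exact bci_norm_sub_natCast_eq_one (p := p) hdx
      (bci_not_dvd_sub (mem_range.1 hd) (mem_range.1 hjp) (Ne.symm hjd))
  rw [← mul_prod_erase _ _ hd, hothers, mul_one] at h
  exact h

/-! ## §2. Descent of the hypothesis from `x` to `y = (x − d)/p` -/

omit hp in
/-- If `j % p ≠ d` (`d < p`) then `p ∤ d − j`. [folklore] -/
private theorem bci_not_dvd_sub_of_mod_ne {d j : ℕ} (hd : d < p) (hj : j % p ≠ d) :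
    ¬ (p : ℤ) ∣ ((d : ℤ) - j) := by
  intro hdvd
  apply hj
  have h1 : (j : ℤ) % p = (d : ℤ) % p := Int.modEq_iff_dvd.2 hdvd
  have h2 : ((j % p : ℕ) : ℤ) = ((d % p : ℕ) : ℤ) := by push_cast; exact h1
  have h3 : j % p = d % p := by exact_mod_cast h2
  rw [h3, Nat.mod_eq_of_lt hd]

/-- **Descent.** If `‖x − d‖ < 1` (`d < p`) and `‖∏_{j<p^{N+1}}(x − j)‖ ≤ ‖(p^{N+1})!‖`, then
`y = (x − d)/p` satisfies `‖∏_{i<p^N}(y − i)‖ ≤ ‖(p^N)!‖`: the factors `j ≢ d (mod p)` have norm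
`1`, the factors `j = d + pi` are `p·(y − i)`, and `‖(p^{N+1})!‖ = ‖p‖^{p^N}‖(p^N)!‖`.
[cite: Gouvea1993PadicNumbers, §5.9 Lemma 5.9.1 (converse) and Problem 194] -/
theorem norm_descPochhammer_prime_pow_le_descend {x : F} {d : ℕ} (hd : d < p) (hxd : ‖x - d‖ < 1)
    {N : ℕ} (h : ‖∏ j ∈ range (p ^ (N + 1)), (x - (j : F))‖ ≤ ‖((p ^ (N + 1)).factorial : F)‖) :
    ‖∏ i ∈ range (p ^ N), ((x - d) / p - (i : F))‖ ≤ ‖((p ^ N).factorial : F)‖ := by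
  have : IsUltrametricDist F := IsUltrametricDist.of_normedAlgebra ℚ_[p]
  -- the sub-progression `j = d + p i`, `i < p^N`
  set S : Finset ℕ := (range (p ^ N)).image (fun i ↦ d + p * i) with hS
  have hinj : Set.InjOn (fun i ↦ d + p * i) (range (p ^ N) : Set ℕ) := by
    intro a _ b _ hab
    have := hp.out.pos
    simp only at hab
    exact Nat.eq_of_mul_eq_mul_left this (by omega)
  have hSsub : S ⊆ range (p ^ (N + 1)) := by
    intro j hj
    obtain ⟨i, hi, rfl⟩ := mem_image.1 hj
    rw [mem_range] at hi ⊢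
    rw [pow_succ]
    nlinarith [hp.out.pos]
  -- factors off the progression have norm `1`
  have hoff : ∏ j ∈ range (p ^ (N + 1)) \ S, ‖x - (j : F)‖ = 1 := by
    refine prod_eq_one fun j hj ↦ ?_
    obtain ⟨hjr, hjS⟩ := mem_sdiff.1 hj
    refine bci_norm_sub_natCast_eq_one (p := p) hxd (bci_not_dvd_sub_of_mod_ne hd fun hmod ↦ hjS ?_)
    refine mem_image.2 ⟨j / p, ?_, ?_⟩
    · rw [mem_range] at hjr ⊢
      rw [pow_succ] at hjr
      exact Nat.div_lt_of_lt_mul (by rwa [mul_comm] at hjr)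
    · have := Nat.mod_add_div j p
      rw [hmod] at this
      exact this
  -- factors on the progression: `x − (d + p i) = p · (y − i)`
  have hon : ∏ j ∈ S, (x - (j : F)) = (p : F) ^ (p ^ N) * ∏ i ∈ range (p ^ N), ((x - d) / p - (i : F)) := by
    rw [hS, prod_image hinj, ← card_range (p ^ N), ← prod_const, card_range, ← prod_mul_distrib]
    refine prod_congr rfl fun i _ ↦ ?_
    have hp0 := bci_p_ne_zero (F := F) (p := p)
    field_simp
    push_cast
    ring
  -- assemble
  have hsplit : ∏ j ∈ range (p ^ (N + 1)), (x - (j : F)) =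
      (∏ j ∈ range (p ^ (N + 1)) \ S, (x - (j : F))) * ∏ j ∈ S, (x - (j : F)) :=
    (prod_sdiff hSsub).symm
  rw [hsplit, norm_mul, norm_prod, hoff, one_mul, hon, norm_mul, norm_pow, pow_succ, mul_comm (p ^ N) p,
    bci_norm_factorial_mul (p := p)] at h
  exact le_of_mul_le_mul_left h (pow_pos (bci_norm_p_pos (p := p)) _)

/-! ## §3. Iteration: `x` is approximated by natural numbers to every order -/

/-- **All digits.** If `‖x‖ ≤ 1` and `‖∏_{j<p^N}(x − j)‖ ≤ ‖(p^N)!‖` for every `N`, then for every `k`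
there is `m ∈ ℕ` with `‖x − m‖ ≤ ‖p‖^k` (the first `k` digits of `x`).
[cite: Gouvea1993PadicNumbers, §5.9 Lemma 5.9.1 (converse) and Problem 194] -/
theorem exists_nat_norm_sub_le_of_norm_descPochhammer_prime_pow_le (k : ℕ) {x : F} (hx : ‖x‖ ≤ 1)
    (h : ∀ N : ℕ, ‖∏ j ∈ range (p ^ N), (x - (j : F))‖ ≤ ‖((p ^ N).factorial : F)‖) :
    ∃ m : ℕ, ‖x - m‖ ≤ ‖(p : F)‖ ^ k := by
  induction k generalizing x with
  | zero => exact ⟨0, by simpa using hx⟩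
  | succ k ih =>
    obtain ⟨d, hd, hxd⟩ := exists_digit_of_norm_descPochhammer_le (p := p) hx (by simpa using h 1)
    have hxd' : ‖x - d‖ < 1 := hxd.trans_lt (bci_norm_p_lt_one (p := p))
    have hp0 := bci_p_ne_zero (F := F) (p := p)
    set y : F := (x - d) / p with hy
    have hy1 : ‖y‖ ≤ 1 := by
      rw [hy, norm_div, div_le_one (bci_norm_p_pos (p := p))]
      exact hxd
    have hyN : ∀ N : ℕ, ‖∏ j ∈ range (p ^ N), (y - (j : F))‖ ≤ ‖((p ^ N).factorial : F)‖ :=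
      fun N ↦ norm_descPochhammer_prime_pow_le_descend (p := p) hd hxd' (h (N + 1))
    obtain ⟨m, hm⟩ := ih hy1 hyN
    refine ⟨d + p * m, ?_⟩
    have hxm : x - ((d + p * m : ℕ) : F) = (p : F) * (y - m) := by
      rw [hy]; field_simp; push_cast; ring
    rw [hxm, norm_mul, pow_succ']
    exact mul_le_mul_of_nonneg_left hm (norm_nonneg _)

/-! ## §4. The theorem -/

include instF in
/-- The image of `ℤ_p` in `F` is closed (it is compact). [folklore] -/
private theorem bci_isClosed_range :
    IsClosed (Set.range (fun z : ℤ_[p] ↦ algebraMap ℚ_[p] F (z : ℚ_[p]))) := by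
  have hc : Continuous (fun z : ℤ_[p] ↦ algebraMap ℚ_[p] F (z : ℚ_[p])) :=
    (continuous_algebraMap ℚ_[p] F).comp continuous_subtype_val
  exact (isCompact_range hc).isClosed

/-- **Converse of Gouvêa's Lemma 5.9.1, prime-power form.** If `‖x‖ ≤ 1` and
`‖x(x−1)⋯(x−p^N+1)‖ ≤ ‖(p^N)!‖` for every `N`, then `x ∈ ℤ_p`. (Gouvêa's Problem 194 asks for the
behaviour of the binomial series when `α ∉ ℤ_p`; this is the answer "its coefficients are not all
`p`-integral", in contrapositive form.)
[cite: Gouvea1993PadicNumbers, §5.9 Lemma 5.9.1 (converse) and Problem 194] -/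
theorem exists_padicInt_eq_of_norm_descPochhammer_prime_pow_le {x : F} (hx : ‖x‖ ≤ 1)
    (h : ∀ N : ℕ, ‖∏ j ∈ range (p ^ N), (x - (j : F))‖ ≤ ‖((p ^ N).factorial : F)‖) :
    ∃ z : ℤ_[p], algebraMap ℚ_[p] F (z : ℚ_[p]) = x := by
  -- a sequence of naturals converging to `x`
  choose m hm using fun k ↦ exists_nat_norm_sub_le_of_norm_descPochhammer_prime_pow_le (p := p) k hx h
  have hlim : Tendsto (fun k ↦ ((m k : ℕ) : F)) atTop (𝓝 x) := by
    rw [tendsto_iff_norm_sub_tendsto_zero]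
    refine squeeze_zero (fun _ ↦ norm_nonneg _) (fun k ↦ by simpa [norm_sub_rev] using hm k) ?_
    exact tendsto_pow_atTop_nhds_zero_of_lt_one (norm_nonneg _) (bci_norm_p_lt_one (F := F) (p := p))
  have hmem : x ∈ Set.range (fun z : ℤ_[p] ↦ algebraMap ℚ_[p] F (z : ℚ_[p])) :=
    (bci_isClosed_range (F := F) (p := p)).mem_of_tendsto hlim
      (Eventually.of_forall fun k ↦ ⟨(m k : ℕ), by simp⟩)
  exact hmem

/-- **Converse of Gouvêa's Lemma 5.9.1.** If every "binomial coefficient numerator" satisfies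
`‖x(x−1)⋯(x−n+1)‖ ≤ ‖n!‖` (i.e. `‖C(x, n)‖ ≤ 1` for all `n`), then `x ∈ ℤ_p`.
[cite: Gouvea1993PadicNumbers, §5.9 Lemma 5.9.1 (converse) and Problem 194] -/
theorem exists_padicInt_eq_of_norm_descPochhammer_le {x : F}
    (h : ∀ n : ℕ, ‖∏ j ∈ range n, (x - (j : F))‖ ≤ ‖(n.factorial : F)‖) :
    ∃ z : ℤ_[p], algebraMap ℚ_[p] F (z : ℚ_[p]) = x := by
  have hx : ‖x‖ ≤ 1 := by simpa using h 1
  exact exists_padicInt_eq_of_norm_descPochhammer_prime_pow_le (p := p) hx fun N ↦ h (p ^ N)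

/-- The same with the descending Pochhammer polynomial: `‖(descPochhammer F n)(x)‖ ≤ ‖n!‖` for all
`n` implies `x ∈ ℤ_p`. [cite: Gouvea1993PadicNumbers, §5.9 Lemma 5.9.1 (converse) and Problem 194] -/
theorem exists_padicInt_eq_of_norm_descPochhammer_eval_le {x : F}
    (h : ∀ n : ℕ, ‖(descPochhammer F n).eval x‖ ≤ ‖(n.factorial : F)‖) :
    ∃ z : ℤ_[p], algebraMap ℚ_[p] F (z : ℚ_[p]) = x :=
  exists_padicInt_eq_of_norm_descPochhammer_le (p := p) fun n ↦ by
    rw [← descPochhammer_eval_eq_prod_range]; exact h n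

/-! ## §5. Lemma 5.9.1 itself in the same currency, and the `iff` -/

/-- **Gouvêa's Lemma 5.9.1** (`C(z, n) ∈ ℤ_p` for `z ∈ ℤ_p`) in norm form: for `z ∈ ℤ_p`,
`‖z(z−1)⋯(z−n+1)‖ ≤ ‖n!‖` in `F`. [cite: Gouvea1993PadicNumbers, §5.9 Lemma 5.9.1] -/
theorem norm_descPochhammer_le_of_padicInt (z : ℤ_[p]) (n : ℕ) :
    ‖∏ j ∈ range n, (algebraMap ℚ_[p] F (z : ℚ_[p]) - (j : F))‖ ≤ ‖(n.factorial : F)‖ := by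
  -- `∏ (z − j) = n! · C(z, n)` in `ℤ_p`
  have hZ : ∏ j ∈ range n, ((z : ℤ_[p]) - (j : ℤ_[p])) = (n.factorial : ℤ_[p]) * Ring.choose z n := by
    rw [← descPochhammer_eval_eq_prod_range, ← nsmul_eq_mul,
      ← Ring.descPochhammer_eq_factorial_smul_choose, ← Polynomial.eval₂_smulOneHom_eq_smeval,
      ← descPochhammer_map (Int.castRingHom ℤ_[p]), Polynomial.eval_map,
      Subsingleton.elim (Int.castRingHom ℤ_[p]) RingHom.smulOneHom]
  have hmap : ∏ j ∈ range n, (algebraMap ℚ_[p] F (z : ℚ_[p]) - (j : F)) =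
      algebraMap ℚ_[p] F (PadicInt.Coe.ringHom (∏ j ∈ range n, ((z : ℤ_[p]) - (j : ℤ_[p])))) := by
    rw [map_prod, map_prod]
    refine prod_congr rfl fun j _ ↦ ?_
    rw [map_sub, map_sub, map_natCast, map_natCast]
    rfl
  rw [hmap, norm_algebraMap', hZ, map_mul, norm_mul, map_natCast,
    ← bci_norm_natCast (F := F) (p := p)]
  exact mul_le_of_le_one_right (norm_nonneg _) (PadicInt.norm_le_one _)

/-- **`‖C(x, n)‖ ≤ 1` for all `n` iff `x ∈ ℤ_p`** (Lemma 5.9.1 and its converse).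
[cite: Gouvea1993PadicNumbers, §5.9 Lemma 5.9.1] -/
theorem norm_descPochhammer_le_iff_mem_range_padicInt (x : F) :
    (∀ n : ℕ, ‖∏ j ∈ range n, (x - (j : F))‖ ≤ ‖(n.factorial : F)‖) ↔
      x ∈ Set.range (fun z : ℤ_[p] ↦ algebraMap ℚ_[p] F (z : ℚ_[p])) := by
  constructor
  · exact fun h ↦ exists_padicInt_eq_of_norm_descPochhammer_le (p := p) h
  · rintro ⟨z, rfl⟩ n
    exact norm_descPochhammer_le_of_padicInt (p := p) z n

/-! ## §6. Problem 194, bounded form: `‖C(x, n)‖ ≤ B` for all `n` already forces `x ∈ ℤ_p`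

(Appended.) The binomial series `(1+T)^x` has BOUNDED coefficients only for `x ∈ ℤ_p`: if some
`p`-adic digit of `x` fails to exist, `‖C(x, p^N)‖ → ∞`. Two failure modes at a level: no residue
digit at all (`‖x − j‖ = 1` for all `j`, then `‖x(x−1)⋯(x−p^N+1)‖ = 1` while `‖(p^N)!‖ → 0`), or a
residue digit `d` with `‖p‖ < ‖x − d‖ < 1` (then `‖x(x−1)⋯(x−p^{N+1}+1)‖ = ‖x − d‖^{p^N}` against
`‖(p^{N+1})!‖ ≤ ‖p‖^{p^N}`). -/

include instF in
/-- If `‖x‖ > 1` then `‖x(x−1)⋯(x−n+1)‖ = ‖x‖ⁿ`. [folklore] -/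
private theorem bci_norm_prod_eq_pow_of_one_lt {x : F} (hx : 1 < ‖x‖) (n : ℕ) :
    ‖∏ j ∈ range n, (x - (j : F))‖ = ‖x‖ ^ n := by
  have : IsUltrametricDist F := IsUltrametricDist.of_normedAlgebra ℚ_[p]
  have hj : ∀ j ∈ range n, ‖x - (j : F)‖ = ‖x‖ := fun j _ ↦ by
    have hlt : ‖-(j : F)‖ < ‖x‖ := by
      rw [norm_neg]; exact lt_of_le_of_lt (bci_norm_natCast_le_one (p := p) j) hx
    rw [sub_eq_add_neg, IsUltrametricDist.norm_add_eq_max_of_norm_ne_norm hlt.ne', max_eq_left hlt.le]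
  rw [norm_prod, prod_congr rfl hj, prod_const, card_range]

include instF in
/-- A bounded hypothesis `‖x(x−1)⋯(x−n+1)‖ ≤ B·‖n!‖` forces `‖x‖ ≤ 1`. [folklore] -/
private theorem bci_norm_le_one_of_bounded {x : F} {B : ℝ}
    (h : ∀ n : ℕ, ‖∏ j ∈ range n, (x - (j : F))‖ ≤ B * ‖(n.factorial : F)‖) : ‖x‖ ≤ 1 := by
  by_contra hx
  push Not at hx
  have hB0 : 0 ≤ B := by
    have h0 := h 0
    simp only [range_zero, prod_empty, norm_one, Nat.factorial_zero, Nat.cast_one, mul_one] at h0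
    linarith
  have hB : ∀ n : ℕ, ‖x‖ ^ n ≤ B := fun n ↦ by
    have h1 := h n
    rw [bci_norm_prod_eq_pow_of_one_lt (p := p) hx] at h1
    exact h1.trans (mul_le_of_le_one_right hB0 (bci_norm_natCast_le_one (p := p) _))
  obtain ⟨n, hn⟩ := ((tendsto_pow_atTop_atTop_of_one_lt hx).eventually_gt_atTop B).exists
  exact absurd (hB n) (not_le.2 hn)

/-- **Block decomposition.** If `‖x − d‖ < 1` (`d < p`) then
`‖∏_{j<p^{N+1}}(x − j)‖ = ∏_{i<p^N} ‖x − (d + p·i)‖`: the factors off the progression `j ≡ d (mod p)`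
have norm `1`. [folklore] -/
private theorem bci_norm_prod_eq_block {x : F} {d : ℕ} (hd : d < p) (hxd : ‖x - d‖ < 1) (N : ℕ) :
    ‖∏ j ∈ range (p ^ (N + 1)), (x - (j : F))‖ = ∏ i ∈ range (p ^ N), ‖x - ((d + p * i : ℕ) : F)‖ := by
  have : IsUltrametricDist F := IsUltrametricDist.of_normedAlgebra ℚ_[p]
  set S : Finset ℕ := (range (p ^ N)).image (fun i ↦ d + p * i) with hS
  have hinj : Set.InjOn (fun i ↦ d + p * i) (range (p ^ N) : Set ℕ) := by
    intro a _ b _ hab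
    have := hp.out.pos
    simp only at hab
    exact Nat.eq_of_mul_eq_mul_left this (by omega)
  have hSsub : S ⊆ range (p ^ (N + 1)) := by
    intro j hj
    obtain ⟨i, hi, rfl⟩ := mem_image.1 hj
    rw [mem_range] at hi ⊢
    rw [pow_succ]
    nlinarith [hp.out.pos]
  have hoff : ∏ j ∈ range (p ^ (N + 1)) \ S, ‖x - (j : F)‖ = 1 := by
    refine prod_eq_one fun j hj ↦ ?_
    obtain ⟨hjr, hjS⟩ := mem_sdiff.1 hj
    refine bci_norm_sub_natCast_eq_one (p := p) hxd (bci_not_dvd_sub_of_mod_ne hd fun hmod ↦ hjS ?_)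
    refine mem_image.2 ⟨j / p, ?_, ?_⟩
    · rw [mem_range] at hjr ⊢
      rw [pow_succ] at hjr
      exact Nat.div_lt_of_lt_mul (by rwa [mul_comm] at hjr)
    · have := Nat.mod_add_div j p
      rw [hmod] at this
      exact this
  rw [← prod_sdiff hSsub, norm_mul, norm_prod, hoff, one_mul, norm_prod, hS, prod_image hinj]

/-- `‖(p^N)!‖ ≤ ‖p‖^N` (crude form of Legendre). [folklore] -/
private theorem bci_norm_factorial_prime_pow_le (N : ℕ) :
    ‖((p ^ N).factorial : F)‖ ≤ ‖(p : F)‖ ^ N := by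
  induction N with
  | zero => simp
  | succ N ih =>
    rw [pow_succ, mul_comm (p ^ N) p, bci_norm_factorial_mul (p := p), pow_succ, mul_comm (‖(p:F)‖ ^ N)]
    refine mul_le_mul ?_ ih (norm_nonneg _) (norm_nonneg _)
    exact pow_le_of_le_one (norm_nonneg _) (bci_norm_p_lt_one (p := p)).le
      (pow_ne_zero _ hp.out.ne_zero)

/-- `‖(j % p) − j‖ ≤ ‖p‖ < 1` for naturals. [folklore] -/
private theorem bci_norm_mod_sub_lt_one (j : ℕ) : ‖((j % p : ℕ) : F) - (j : F)‖ < 1 := by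
  have h := Nat.mod_add_div j p
  have hj : (j : F) = ((j % p : ℕ) : F) + (p : F) * ((j / p : ℕ) : F) := by
    have h' := congrArg (Nat.cast : ℕ → F) h.symm
    push_cast at h'
    exact h'
  rw [hj, sub_add_cancel_left, norm_neg, norm_mul]
  exact lt_of_le_of_lt (mul_le_of_le_one_right (norm_nonneg _) (bci_norm_natCast_le_one (p := p) _))
    (bci_norm_p_lt_one (p := p))

/-- **The digit step, bounded form.** If `‖x‖ ≤ 1` and `‖x(x−1)⋯(x−p^N+1)‖ ≤ B·‖(p^N)!‖` for all `N`,
then `‖x − d‖ ≤ ‖p‖` for some `d < p`. [cite: Gouvea1993PadicNumbers, §5.9 Lemma 5.9.1 (converse) and Problem 194] -/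
theorem exists_digit_of_norm_descPochhammer_le_mul {x : F} (hx : ‖x‖ ≤ 1) {B : ℝ}
    (h : ∀ N : ℕ, ‖∏ j ∈ range (p ^ N), (x - (j : F))‖ ≤ B * ‖((p ^ N).factorial : F)‖) :
    ∃ d : ℕ, d < p ∧ ‖x - d‖ ≤ ‖(p : F)‖ := by
  have : IsUltrametricDist F := IsUltrametricDist.of_normedAlgebra ℚ_[p]
  have hp0 := bci_norm_p_pos (F := F) (p := p)
  have hp1 := bci_norm_p_lt_one (F := F) (p := p)
  have hB0 : 0 ≤ B := by
    have h0 := h 0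
    simp only [pow_zero, range_one, prod_singleton, Nat.cast_zero, sub_zero, Nat.factorial_one,
      Nat.cast_one, norm_one, mul_one] at h0
    exact (norm_nonneg x).trans h0
  by_cases hdig : ∃ d : ℕ, d < p ∧ ‖x - d‖ < 1
  · -- a residue digit `d`; show `‖x − d‖ ≤ ‖p‖`
    obtain ⟨d, hd, hxd⟩ := hdig
    refine ⟨d, hd, ?_⟩
    by_contra hlt
    push Not at hlt
    -- on the progression every factor has norm `r = ‖x − d‖`
    have hblock : ∀ N, ‖∏ j ∈ range (p ^ (N + 1)), (x - (j : F))‖ = ‖x - d‖ ^ p ^ N := by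
      intro N
      rw [bci_norm_prod_eq_block (p := p) hd hxd N]
      have hi : ∀ i ∈ range (p ^ N), ‖x - ((d + p * i : ℕ) : F)‖ = ‖x - d‖ := fun i _ ↦ by
        have hsplit : x - ((d + p * i : ℕ) : F) = (x - d) + (-((p : F) * i)) := by push_cast; ring
        have hsmall : ‖-((p : F) * i)‖ < ‖x - d‖ := by
          rw [norm_neg, norm_mul]
          exact lt_of_le_of_lt (mul_le_of_le_one_right (norm_nonneg _)
            (bci_norm_natCast_le_one (p := p) i)) hlt
        rw [hsplit, IsUltrametricDist.norm_add_eq_max_of_norm_ne_norm hsmall.ne', max_eq_left hsmall.le]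
      rw [prod_congr rfl hi, prod_const, card_range]
    -- `(r/‖p‖)^{p^N} ≤ B` for all `N`, impossible since `r/‖p‖ > 1`
    have hq : 1 < ‖x - (d : F)‖ / ‖(p : F)‖ := (one_lt_div hp0).2 hlt
    have hB : ∀ N, (‖x - (d : F)‖ / ‖(p : F)‖) ^ p ^ N ≤ B := by
      intro N
      have h1 := h (N + 1)
      rw [hblock N, pow_succ, mul_comm (p ^ N) p, bci_norm_factorial_mul (p := p)] at h1
      rw [div_pow, div_le_iff₀ (pow_pos hp0 _)]
      refine h1.trans ?_
      rw [← mul_assoc, mul_comm B]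
      exact mul_le_of_le_one_right (mul_nonneg (pow_nonneg hp0.le _) hB0)
        (bci_norm_natCast_le_one (p := p) _)
    have hpN : Tendsto (fun N : ℕ ↦ p ^ N) atTop atTop :=
      tendsto_pow_atTop_atTop_of_one_lt hp.out.one_lt
    obtain ⟨N, hN⟩ :=
      (((tendsto_pow_atTop_atTop_of_one_lt hq).comp hpN).eventually_gt_atTop B).exists
    exact absurd (hB N) (not_le.2 hN)
  · -- no residue digit: all factors have norm `1`, but `‖(p^N)!‖ → 0`
    push Not at hdig
    exfalso
    have hone : ∀ j : ℕ, ‖x - (j : F)‖ = 1 := by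
      intro j
      have hr : j % p < p := Nat.mod_lt _ hp.out.pos
      have h1 : ‖x - ((j % p : ℕ) : F)‖ = 1 :=
        le_antisymm ((bci_norm_sub_le_max x _).trans (max_le hx (bci_norm_natCast_le_one (p := p) _)))
          (hdig _ hr)
      have hsplit : x - (j : F) = (x - ((j % p : ℕ) : F)) + (((j % p : ℕ) : F) - j) := by ring
      have hsmall := bci_norm_mod_sub_lt_one (F := F) (p := p) j
      rw [hsplit, IsUltrametricDist.norm_add_eq_max_of_norm_ne_norm (by rw [h1]; exact hsmall.ne'), h1]
      exact max_eq_left hsmall.le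
    have hB : ∀ N, (1 : ℝ) ≤ B * ‖(p : F)‖ ^ N := by
      intro N
      have h1 := h N
      rw [norm_prod, prod_eq_one (fun j _ ↦ hone j)] at h1
      exact h1.trans (mul_le_mul_of_nonneg_left (bci_norm_factorial_prime_pow_le (p := p) N) hB0)
    have hlim : Tendsto (fun N : ℕ ↦ B * ‖(p : F)‖ ^ N) atTop (𝓝 0) := by
      simpa using (tendsto_pow_atTop_nhds_zero_of_lt_one hp0.le hp1).const_mul B
    have := ge_of_tendsto' hlim hB
    linarith

/-- **Converse of Gouvêa's Lemma 5.9.1, bounded form (Problem 194).** If the binomial coefficients of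
`x` are merely BOUNDED — `‖x(x−1)⋯(x−n+1)‖ ≤ B·‖n!‖` for all `n` — then `x ∈ ℤ_p`. Equivalently: for
`x ∉ ℤ_p` the coefficients `C(x,n)` of the binomial series `(1+T)^x` are unbounded (its radius of
convergence is `< 1`). [cite: Gouvea1993PadicNumbers, §5.9 Lemma 5.9.1 (converse) and Problem 194] -/
theorem exists_padicInt_eq_of_norm_descPochhammer_le_mul {x : F} {B : ℝ}
    (h : ∀ n : ℕ, ‖∏ j ∈ range n, (x - (j : F))‖ ≤ B * ‖(n.factorial : F)‖) :
    ∃ z : ℤ_[p], algebraMap ℚ_[p] F (z : ℚ_[p]) = x := by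
  have hx : ‖x‖ ≤ 1 := bci_norm_le_one_of_bounded (p := p) h
  -- all digits, with the bound `B` carried along the descent
  have hstep : ∀ (k : ℕ) (y : F), ‖y‖ ≤ 1 →
      (∀ N : ℕ, ‖∏ j ∈ range (p ^ N), (y - (j : F))‖ ≤ B * ‖((p ^ N).factorial : F)‖) →
      ∃ m : ℕ, ‖y - m‖ ≤ ‖(p : F)‖ ^ k := by
    intro k
    induction k with
    | zero => intro y hy _; exact ⟨0, by simpa using hy⟩
    | succ k ih =>
      intro y hy hyN
      obtain ⟨d, hd, hyd⟩ := exists_digit_of_norm_descPochhammer_le_mul (p := p) hy hyN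
      have hyd' : ‖y - d‖ < 1 := hyd.trans_lt (bci_norm_p_lt_one (p := p))
      have hp0 := bci_p_ne_zero (F := F) (p := p)
      set y' : F := (y - d) / p with hy'
      have hy'1 : ‖y'‖ ≤ 1 := by
        rw [hy', norm_div, div_le_one (bci_norm_p_pos (p := p))]; exact hyd
      have hy'N : ∀ N : ℕ, ‖∏ j ∈ range (p ^ N), (y' - (j : F))‖ ≤ B * ‖((p ^ N).factorial : F)‖ := by
        intro N
        have h1 := hyN (N + 1)
        rw [bci_norm_prod_eq_block (p := p) hd hyd' N, pow_succ, mul_comm (p ^ N) p,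
          bci_norm_factorial_mul (p := p)] at h1
        have h2 : ∏ i ∈ range (p ^ N), ‖y - ((d + p * i : ℕ) : F)‖ =
            ‖(p : F)‖ ^ p ^ N * ‖∏ i ∈ range (p ^ N), (y' - (i : F))‖ := by
          rw [norm_prod, ← card_range (p ^ N), ← prod_const, card_range, ← prod_mul_distrib]
          refine prod_congr rfl fun i _ ↦ ?_
          rw [← norm_mul]; congr 1; rw [hy']; field_simp; push_cast; ring
        rw [h2] at h1
        have h3 : ‖(p : F)‖ ^ p ^ N * ‖∏ i ∈ range (p ^ N), (y' - (i : F))‖ ≤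
            ‖(p : F)‖ ^ p ^ N * (B * ‖((p ^ N).factorial : F)‖) := h1.trans (le_of_eq (by ring))
        exact le_of_mul_le_mul_left h3 (pow_pos (bci_norm_p_pos (p := p)) _)
      obtain ⟨m, hm⟩ := ih y' hy'1 hy'N
      refine ⟨d + p * m, ?_⟩
      have hym : y - ((d + p * m : ℕ) : F) = (p : F) * (y' - m) := by
        rw [hy']; field_simp; push_cast; ring
      rw [hym, norm_mul, pow_succ']
      exact mul_le_mul_of_nonneg_left hm (norm_nonneg _)
  choose m hm using fun k ↦ hstep k x hx fun N ↦ h (p ^ N)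
  have hlim : Tendsto (fun k ↦ ((m k : ℕ) : F)) atTop (𝓝 x) := by
    rw [tendsto_iff_norm_sub_tendsto_zero]
    refine squeeze_zero (fun _ ↦ norm_nonneg _) (fun k ↦ by simpa [norm_sub_rev] using hm k) ?_
    exact tendsto_pow_atTop_nhds_zero_of_lt_one (norm_nonneg _) (bci_norm_p_lt_one (F := F) (p := p))
  exact (bci_isClosed_range (F := F) (p := p)).mem_of_tendsto hlim
    (Eventually.of_forall fun k ↦ ⟨(m k : ℕ), by simp⟩)

end Literature.NumberTheory.LocalFields
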